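import Literature.MathematicalPhysics.QuantumFieldTheory.Balaban1983to89.B9Eq344HessianSliceTwoBackgroundIdentity
import Literature.MathematicalPhysics.QuantumFieldTheory.Balaban1983to89.B9Eq344HessianSliceTwoBackgroundLetters

/-!
# `Balaban1983to89.B9Eq344CovariantHessianTwoBackgroundRowTower` — T. Bałaban, *Propagators for lattice gauge theories in a background field*, Commun. Math. Phys. **99** (1985)
# 389–434 [Balaban1985BackgroundPropagators] Thm 3.4 p. 400 (*«They satisfy Theorem 3.1 with the additional small factor O(1)α₁»*, p. 403) FOR THE SECOND-ORDER MEMBER (3.44)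
# p. 398 of Thm 3.1, with (3.117)–(3.120) p. 419 and Thm 3.13 p. 426 ((3.36) enters): **THE `cosh`-WEIGHTED FLAT-GRADIENT ROW OF THE DIFFERENCE OF THE COVARIANT HESSIAN SLICES
# OF TWO BACKGROUNDS, `∃ (αH, ΘH, κH)` BEFORE THE HEIGHT** — for `Δ^η_Uu_U = ω_U` and `Δ^η_1u_1 = ω_1` (the flat background read through `Ad(1)`) on the tower, with the
# ONE-background weighted rows of `ω_U` (value `N_ω`, η-Hölder `H_ω`) and `u_U` (value `M_u`, covariant gradient `M_w`, covariant Hessian slice `M_h`) and the TWO-background rows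
# (value `N′` and η-Hölder `H′` of `ω_U − ω_1`; value `M′` of the slice difference `(D_Uu_U)(·,μ) − (D_1u_1)(·,μ)`):
# `‖(D_1((D_Uu_U)(·,μ) − (D_1u_1)(·,μ)))(b)‖ ≤ ΘH·((α + j₀)(N_ω + H_ω + M_u + M_w + M_h) + (N′ + H′ + M′))·W_{x₀}(b₋)` — every one-background row enters with the small factor
# `α + j₀`.  This is the analytic core of the discharge of ROUTE (J′)'s located letter `H3` (gen 102: the `∇_1` letter of the third word `G̃_kD_UR_kD*_UG̃_k = D_UG′_kR_kG′_kD*_U` between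
# two backgrounds = the flat gradient of the slice difference of `u = G′_kR_kG′_kD*_Uf`, a gauge mode with `Δ^η_Uu = ω` EXACTLY by `B9Eq325GreenPrimeOnProjRange`): it reduces
# `H3` to FIRST-ORDER two-background rows (the docking is the next file).
#
# MECHANISM.  The slice identity `B9Eq344HessianSliceTwoBackgroundIdentity.laplace_add_one_hessSlice_sub_eq`:
# `(Δ_1 + 1)(w_U − w_1) = D*_1B + S`, `B = (D_1 − D_U)w_U + (A_{ω_U} − A_{ω_1})` (η-Hölder data), `S = (D*_1 − D*_U)D_Uw_U + (D*_U − D*_1)A_{ω_U} + Comm_μ(u_U) + (w_U − w_1)` (sup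
# data); hence `D_1(w_U − w_1) = [D_1(Δ_1+1)⁻¹D*_1]B + [D_1(Δ_1+1)⁻¹]S`, bounded by gen 95's (3.44)-letter `B9Eq344ResolventGradientRowTower` and gen 93's gradient letter
# `B9Eq342ResolventGradLetterTower` AT THE FLAT BACKGROUND (class radius `0`), the rows of `B` by `B9Eq344HessianSliceTwoBackgroundLetters.{supRow_sliceB, holderRow_sliceB}`
# (transporter defect `2M_φM_φ′αη`, Lipschitz letter `2M_φM_φ′dαη²` along parallel bonds from the all-direction window (3.35) by the lattice path lemma), the sup data by
# `norm_covDiv_trivial_sub_covDiv_apply_le` and `B9Eq3117CommutatorBound.norm_commutator_sum_le` (`2‖J‖ + 8dα²η ≤ 8d(j₀ + α)`).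

statement-level skeleton of published theorems with citation tags; proofs where landed; nothing here is a claim about the Yang–Mills mass gap

CITATION HEADER (lean-in-tree rule).  Audit cell `pub-balaban`, sub-cell `t4`, BINDER row NE9; filed by NE9 crux-team LEAF PROVER 01 (`b2b-balaban-t4-ne9-formalise-leaf-01`,
gen 103; bears_on: R4/N22).  Source READ first-hand (`paper:balaban1985-cmp99-background-propagators`, pp. 394–398, 400, 402–403, 419, 426).  REUSED BY NAME: the files named
above and `B9Eq384RemainderLetters.norm_adTransportW_sub_le`, `B9Eq373TransporterLipschitzLetters.norm_adTransportW_sub_adTransportW_le`, `B9Eq342GreenPrimeSupBound.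
norm_adTransportW_eq`, `B9Eq342CovariantResolventAdjointRowLetters.rePos_covLaplaceSiteK_add`, `B9Eq310HessianHermitian.adTransportW_adjoint`, `B9Eq315QTowerFlat.UlevOf_one`,
`B5Eq172HodgePositivity.adTransportW_{one,inv_one}`.  Nothing printed is a hypothesis.

WHAT IS PROVED (sorry-free; proof lane — 0 `def`).
* **`exists_flatGradRow_hessSlice_sub_flat`** (`1 ≤ d`, `L ≥ 3`) — the displayed row, `ΘH = ΘG(18P + 42dP + 36dP² + 6) + Θg(24dP + 1)`, `P = M_φM_φ′`, `αH = 1`,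
  `κH = min(1, κG, κg)`; binders: the tower diagonal, the class (`U ∈ U1`, `‖U − 1‖ ≤ αη`, all-direction window, `plaqU` window, `‖J‖ ≤ j₀`, `U* = U⁻¹`), the flat positivity
  witness of `Δ′_{a′,k}(1)`, the rate (`adL^{n+1} ≤ κH`, `aL^{n+1} ≤ 1`, the `cosh` window), the centre, the fields, the eight rows.
HONEST SCOPE.  A letter on the MODEL's carrier (generic `u_U, ω_U, u_1, ω_1`); the one-background Hessian slice row `M_h` is an INPUT (supplied by gen 95's
`B9Eq344CovariantHessianRowTower` in the docking); nothing of print's Thm 3.1 ∕ 3.4 ∕ 3.13 on print's objects is asserted; «NE9 ⇐ the named binders»; NE9 NOT PRINTED ∕ NOT PROVED;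
row WALLED ON A MODEL (O-NE9-1; #5 UNRULED); spine PROVED 0∕9; rung (B)+1 on a finite T⁴ — NOT infinite volume, NOT mass gap, NOT BetaPertH, NOT Clay.  HONEST DEPENDENCY: continuum
YM on T⁴ ⇐ BetaPertH ∧ nine spine estimates (0/9 proved); BetaPertH ⇐ (D1) ∧ (D4) ∧ CAP+tail; G-an2-4 gates asym, D1 and NE2/3/4.  NEW file; nothing modified.  Net new unproved facts: 0.
-/


noncomputable section

open scoped InnerProductSpace BigOperators

namespace Literature.MathematicalPhysics.QuantumFieldTheory.Balaban1983to89.B9Eq344CovariantHessianTwoBackgroundRowTower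

open B4Sect5Torus (TSite tdist tdist_nonneg tdist_symm)
open B4TorusKernel.MultiPeriod (circAbs)
open B9SectCLatticeCarrier (Bond bpos btgt shift unshift)
open B9Eq311L2Pairing (WL2)
open B7Prop1Explicit (U1 mem_U1 norm_inv_sub_one_le)
open B9Eq310HessianOperator (adTransportW)
open B9Eq315QTower (towerP towerP_apply UlevOf)
open B9Eq315QTowerFlat (UlevOf_one)
open B9Eq324DeltaPrimeATower (laplacePrimeAk)
open B11Eq103H1Complex (SiteL2K BondL2K covDerivL2K covDivL2K covLaplaceSiteK greenK greenK_apply equiv_covDerivL2K equiv_covDivL2K)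
open B9Eq33CovDerivVector (covDeriv covDiv shiftEquiv)
open B9Eq39Adjoint (plaqU J)
open B9Eq384RemainderLetters (norm_adTransportW_sub_le)
open B9Eq342GreenPrimeSupBound (norm_adTransportW_eq)
open B9Eq342GradientRowNaturalPerturbation (weight_site_shift_le weight_site_unshift_le)
open B9Eq342CoshWeightSite (weight_site_pos)
open B9Eq342ResolventGradLetterTower (exists_gradLetter_resolvent)
open B9Eq344ResolventGradientRowTower (exists_gradRow_resolvent_covDiv_holder)
open B9Eq3117CommutatorBound (norm_commutator_sum_le adTransportW_inv_adTransportW')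
open B9Eq373TransporterLipschitzLetters (norm_adTransportW_sub_adTransportW_le)
open B9Eq342CovariantResolventAdjointRowLetters (rePos_covLaplaceSiteK_add)
open B9Eq310HessianHermitian (adTransportW_adjoint)
open B9Eq340HolderRowOfGradientRow (norm_sub_le_of_step_bound)
open B9Eq344HessianSliceTwoBackgroundIdentity (laplace_add_one_hessSlice_sub_eq)
open B9Eq344HessianSliceTwoBackgroundLetters (covDeriv_trivial_sub_covDeriv_apply norm_covDiv_trivial_sub_covDiv_apply_le norm_A_apply_le supRow_sliceB holderRow_sliceB)

section Main

variable {d : ℕ} (L : ℕ) [NeZero L] (hL3 : 3 ≤ L)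
  {𝔸 : Type*} [NormedRing 𝔸] [NormedAlgebra ℂ 𝔸] [CompleteSpace 𝔸] [NormOneClass 𝔸] [StarRing 𝔸]
  {W : Type*} [NormedAddCommGroup W] [InnerProductSpace ℂ W] [FiniteDimensional ℂ W] (φ : W ≃ₗ[ℂ] 𝔸)
  {a' Mφ Mφ' : ℝ} (hMφ : 0 ≤ Mφ) (hMφ' : 0 ≤ Mφ') (hφ : ∀ w, ‖φ w‖ ≤ Mφ * ‖w‖) (hφ' : ∀ X, ‖φ.symm X‖ ≤ Mφ' * ‖X‖) (ha' : 0 < a')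
  {r : ℝ} (hr0 : 0 ≤ r) (hr1 : r < 1)
  (τ : 𝔸 →ₗ[ℂ] ℂ) (hτ₂ : ∀ X Y : 𝔸, τ (X * Y) = τ (Y * X)) (hφτ : ∀ X Y : 𝔸, ⟪φ.symm X, φ.symm Y⟫_ℂ = τ (star X * Y))

/-- arithmetic of the constant (outside the big context): the Hölder-data rows `F_B + H_B` against `X = (α + j₀)Σ₁ + Σ₂`. [folklore] -/
private theorem const_FH_le {P α j₀ dd Nω Hω Mu Mw Mh N' H' M' : ℝ} (hP : 0 ≤ P) (hα : 0 ≤ α) (hα1 : α ≤ 1) (hj : 0 ≤ j₀) (hd : 1 ≤ dd)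
    (hN : 0 ≤ Nω) (hH : 0 ≤ Hω) (hMu : 0 ≤ Mu) (hMw : 0 ≤ Mw) (hMh : 0 ≤ Mh) (hN' : 0 ≤ N') (hH' : 0 ≤ H') (hM' : 0 ≤ M') :
    3 * (2 * P * α * Mw + 2 * P * α * Nω + N') +
        (9 * dd * (2 * P * α) * (Mh + 2 * P * α * Mw) + 3 * dd * (2 * P * α) * Mw + 9 * dd * (2 * P * α) * Nω + 3 * (2 * P * α) * Hω + 3 * H') ≤
      (18 * P + 42 * dd * P + 36 * dd * P ^ 2 + 6) * ((α + j₀) * (Nω + Hω + Mu + Mw + Mh) + (N' + H' + M')) := by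
  obtain ⟨hdd, hρ, hρ0, hSig2⟩ : 0 ≤ dd ∧ α ≤ α + j₀ ∧ 0 ≤ α + j₀ ∧ 0 ≤ N' + H' + M' := ⟨le_trans zero_le_one hd, le_add_of_nonneg_right hj, by positivity, by positivity⟩
  have key : ∀ M : ℝ, 0 ≤ M → M ≤ Nω + Hω + Mu + Mw + Mh → α * M ≤ (α + j₀) * (Nω + Hω + Mu + Mw + Mh) + (N' + H' + M') := fun M hM hMle =>
    ((mul_le_mul_of_nonneg_right hρ hM).trans (mul_le_mul_of_nonneg_left hMle hρ0)).trans (le_add_of_nonneg_right hSig2)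
  obtain ⟨eMw, eNω, eMh, eHω⟩ := And.intro (key Mw hMw (by linarith)) (And.intro (key Nω hN (by linarith)) (And.intro (key Mh hMh (by linarith)) (key Hω hH (by linarith))))
  have e5 : α * (α * Mw) ≤ (α + j₀) * (Nω + Hω + Mu + Mw + Mh) + (N' + H' + M') := (mul_le_of_le_one_left (mul_nonneg hα hMw) hα1).trans eMw
  have eN' : N' ≤ (α + j₀) * (Nω + Hω + Mu + Mw + Mh) + (N' + H' + M') := by nlinarith [mul_nonneg hρ0 (show 0 ≤ Nω + Hω + Mu + Mw + Mh by positivity)]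
  have eH' : H' ≤ (α + j₀) * (Nω + Hω + Mu + Mw + Mh) + (N' + H' + M') := by nlinarith [mul_nonneg hρ0 (show 0 ≤ Nω + Hω + Mu + Mw + Mh by positivity)]
  nlinarith [mul_le_mul_of_nonneg_left eMw hP, mul_le_mul_of_nonneg_left eNω hP, mul_le_mul_of_nonneg_left eMh (mul_nonneg hdd hP),
    mul_le_mul_of_nonneg_left e5 (mul_nonneg hdd (sq_nonneg P)), mul_le_mul_of_nonneg_left eMw (mul_nonneg hdd hP), mul_le_mul_of_nonneg_left eNω (mul_nonneg hdd hP),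
    mul_le_mul_of_nonneg_left eHω hP, eN', eH']

/-- arithmetic of the constant: the sup-data row `G_S` against `X`. [folklore] -/
private theorem const_G_le {P α j₀ dd Nω Hω Mu Mw Mh N' H' M' : ℝ} (hP : 0 ≤ P) (hα : 0 ≤ α) (hj : 0 ≤ j₀) (hd : 1 ≤ dd)
    (hN : 0 ≤ Nω) (hH : 0 ≤ Hω) (hMu : 0 ≤ Mu) (hMw : 0 ≤ Mw) (hMh : 0 ≤ Mh) (hN' : 0 ≤ N') (hH' : 0 ≤ H') (hM' : 0 ≤ M') :
    3 * dd * (2 * P * α) * Mh + 9 * dd * (2 * P * α) * Nω + P * (24 * dd) * ((j₀ + α) * (Mu + Mw)) + M' ≤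
      (24 * dd * P + 1) * ((α + j₀) * (Nω + Hω + Mu + Mw + Mh) + (N' + H' + M')) := by
  obtain ⟨hdd, hρ, hρ0⟩ : 0 ≤ dd ∧ α ≤ α + j₀ ∧ 0 ≤ α + j₀ := ⟨le_trans zero_le_one hd, le_add_of_nonneg_right hj, by positivity⟩
  obtain ⟨h2, h3⟩ := And.intro (mul_le_mul_of_nonneg_right hρ hN : α * Nω ≤ (α + j₀) * Nω) (mul_le_mul_of_nonneg_right hρ hMh : α * Mh ≤ (α + j₀) * Mh)
  nlinarith [mul_nonneg (mul_nonneg hdd hP) (mul_nonneg hρ0 hMw), mul_nonneg (mul_nonneg hdd hP) (mul_nonneg hρ0 hN),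
    mul_nonneg (mul_nonneg hdd hP) (mul_nonneg hρ0 hMh), mul_nonneg (mul_nonneg hdd hP) (mul_nonneg hρ0 hH), mul_nonneg (mul_nonneg hdd hP) (mul_nonneg hρ0 hMu),
    mul_nonneg hdd (mul_nonneg hP (sub_nonneg.2 h2)), mul_nonneg hdd (mul_nonneg hP (sub_nonneg.2 h3)), hN', hH', hM',
    mul_nonneg hρ0 (add_nonneg (add_nonneg (add_nonneg (add_nonneg hN hH) hMu) hMw) hMh), mul_nonneg (mul_nonneg hdd hP) (add_nonneg (add_nonneg hN' hH') hM')]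

include hL3 hMφ hMφ' hφ hφ' ha' hr0 hr1 hτ₂ hφτ in
set_option maxHeartbeats 3200000 in
/-- **THE `cosh`-WEIGHTED FLAT-GRADIENT ROW OF THE DIFFERENCE OF THE HESSIAN SLICES OF TWO BACKGROUNDS** — see the module docstring: for `Δ^η_Uu_U = ω_U`,
`Δ^η_1u_1 = ω_1` with the eight weighted rows, `‖(D_1((D_Uu_U)(·,μ) − (D_1u_1)(·,μ)))(b)‖ ≤ ΘH·((α + j₀)(N_ω + H_ω + M_u + M_w + M_h) + (N′ + H′ + M′))·W_{x₀}(b₋)`.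
[cite: Balaban1985BackgroundPropagators, Thm 3.1 (3.44) p.398, Thm 3.4 p.400, (3.60)–(3.65) pp.402–403, (3.117)–(3.120) p.419, Thm 3.13 p.426, (3.35)–(3.36) p.396] -/
theorem exists_flatGradRow_hessSlice_sub_flat (hd : 1 ≤ d) :
    ∃ αH ΘH κH : ℝ, 0 < αH ∧ 0 ≤ ΘH ∧ 0 < κH ∧
      ∀ (n : ℕ) (η : ℝ), η * (L : ℝ) ^ (n + 1) = 1 →
      ∀ (c₀ c₁ : ℝ) [Fact (0 < c₀)] [Fact (0 < c₁)], c₀ * ((L : ℝ) ^ (n + 1)) ^ d = c₁ →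
      ∀ (m : Fin d → ℕ) [∀ i, NeZero (m i)] (U : Bond d (towerP L m (n + 1)) → 𝔸ˣ),
      ∀ (α : ℝ), 0 ≤ α → α ≤ αH → (∀ b, U b ∈ U1 𝔸) → (∀ b, ‖(U b : 𝔸) - 1‖ ≤ α * η) →
        (∀ (x : TSite d (towerP L m (n + 1))) (μ ν : Fin d), ‖(U (shift ν x, μ) : 𝔸) - (U (x, μ) : 𝔸)‖ ≤ α * η ^ 2) →
        (∀ (κ ν : Fin d) (x : TSite d (towerP L m (n + 1))),
          ‖((plaqU (fun μ => shiftEquiv (Pd := towerP L m (n + 1)) μ) (fun μ y => U (y, μ)) κ ν x : 𝔸ˣ) : 𝔸) - 1‖ ≤ α * η ^ 2) →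
      ∀ (j₀ : ℝ), 0 ≤ j₀ →
        (∀ (μ : Fin d) (y : TSite d (towerP L m (n + 1))), ‖J (fun μ => shiftEquiv (Pd := towerP L m (n + 1)) μ) (fun μ y => U (y, μ)) η μ y‖ ≤ j₀) →
        ∀ (_hUst : ∀ b, star (U b : 𝔸) = ((U b)⁻¹ : 𝔸ˣ))
          (hpos'₁ : ∀ x : SiteL2K ℂ d (towerP L m (n + 1)) c₀ W, x ≠ 0 →
            0 < RCLike.re ⟪x, laplacePrimeAk L m n φ η (fun _ : Bond d (towerP L m (n + 1)) => (1 : 𝔸ˣ)) a' (c₁ := c₁) x⟫_ℂ)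
        (a : ℝ), 0 ≤ a → a * d * (L : ℝ) ^ (n + 1) ≤ κH → a * (L : ℝ) ^ (n + 1) ≤ 1 → 2 * (d : ℝ) * ((L : ℝ) ^ (n + 1)) ^ 2 * (Real.cosh a - 1) ≤ 1 / 2 →
      ∀ (x₀ : TSite d (towerP L m (n + 1))) (uU ωU u1 ω1 : SiteL2K ℂ d (towerP L m (n + 1)) c₀ W) (Nω Hω Mu Mw Mh N' H' M' : ℝ),
        0 ≤ Nω → 0 ≤ Hω → 0 ≤ Mu → 0 ≤ Mw → 0 ≤ Mh → 0 ≤ N' → 0 ≤ H' → 0 ≤ M' →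
        covLaplaceSiteK (c₀ := c₀) ((η : ℂ))⁻¹ (adTransportW φ U) (adTransportW φ fun b => (U b)⁻¹) uU = ωU →
        covLaplaceSiteK (c₀ := c₀) ((η : ℂ))⁻¹ (adTransportW φ (fun _ : Bond d (towerP L m (n + 1)) => (1 : 𝔸ˣ)))
          (adTransportW φ fun b => ((fun _ : Bond d (towerP L m (n + 1)) => (1 : 𝔸ˣ)) b)⁻¹) u1 = ω1 →
        (∀ y, ‖WL2.equiv ℂ (fun _ : TSite d (towerP L m (n + 1)) => c₀) W ωU y‖ ≤ Nω * ∏ ν, Real.cosh (a * (circAbs (towerP L m (n + 1) ν)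
          ((((x₀ ν : ℕ) : ZMod (towerP L m (n + 1) ν)) - ((y ν : ℕ) : ZMod (towerP L m (n + 1) ν))).val) : ℝ))) →
        (∀ (y y' : TSite d (towerP L m (n + 1))), tdist (towerP L m (n + 1)) y y' ≤ (L : ℝ) ^ (n + 1) →
          ‖WL2.equiv ℂ (fun _ : TSite d (towerP L m (n + 1)) => c₀) W ωU y' - WL2.equiv ℂ (fun _ : TSite d (towerP L m (n + 1)) => c₀) W ωU y‖ ≤
            Hω * (∏ ν, Real.cosh (a * (circAbs (towerP L m (n + 1) ν) ((((x₀ ν : ℕ) : ZMod (towerP L m (n + 1) ν)) - ((y ν : ℕ) : ZMod (towerP L m (n + 1) ν))).val) : ℝ))) *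
              (tdist (towerP L m (n + 1)) y y' / (L : ℝ) ^ (n + 1)) ^ ((1 : ℝ) / 2)) →
        (∀ y, ‖WL2.equiv ℂ (fun _ : TSite d (towerP L m (n + 1)) => c₀) W uU y‖ ≤ Mu * ∏ ν, Real.cosh (a * (circAbs (towerP L m (n + 1) ν)
          ((((x₀ ν : ℕ) : ZMod (towerP L m (n + 1) ν)) - ((y ν : ℕ) : ZMod (towerP L m (n + 1) ν))).val) : ℝ))) →
        (∀ b, ‖WL2.equiv ℂ (fun _ : Bond d (towerP L m (n + 1)) => c₀) W (covDerivL2K ℂ c₀ ((η : ℂ))⁻¹ (adTransportW φ U) uU) b‖ ≤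
          Mw * ∏ ν, Real.cosh (a * (circAbs (towerP L m (n + 1) ν) ((((x₀ ν : ℕ) : ZMod (towerP L m (n + 1) ν)) - ((bpos b ν : ℕ) : ZMod (towerP L m (n + 1) ν))).val) : ℝ))) →
      ∀ (μ : Fin d),
        (∀ b, ‖WL2.equiv ℂ (fun _ : Bond d (towerP L m (n + 1)) => c₀) W (covDerivL2K ℂ c₀ ((η : ℂ))⁻¹ (adTransportW φ U)
            ((WL2.equiv ℂ (fun _ : TSite d (towerP L m (n + 1)) => c₀) W).symm fun y =>
              WL2.equiv ℂ (fun _ : Bond d (towerP L m (n + 1)) => c₀) W (covDerivL2K ℂ c₀ ((η : ℂ))⁻¹ (adTransportW φ U) uU) (y, μ))) b‖ ≤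
          Mh * ∏ ν, Real.cosh (a * (circAbs (towerP L m (n + 1) ν) ((((x₀ ν : ℕ) : ZMod (towerP L m (n + 1) ν)) - ((bpos b ν : ℕ) : ZMod (towerP L m (n + 1) ν))).val) : ℝ))) →
        (∀ y, ‖WL2.equiv ℂ (fun _ : TSite d (towerP L m (n + 1)) => c₀) W ωU y - WL2.equiv ℂ (fun _ : TSite d (towerP L m (n + 1)) => c₀) W ω1 y‖ ≤
          N' * ∏ ν, Real.cosh (a * (circAbs (towerP L m (n + 1) ν) ((((x₀ ν : ℕ) : ZMod (towerP L m (n + 1) ν)) - ((y ν : ℕ) : ZMod (towerP L m (n + 1) ν))).val) : ℝ))) →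
        (∀ (y y' : TSite d (towerP L m (n + 1))), tdist (towerP L m (n + 1)) y y' ≤ (L : ℝ) ^ (n + 1) →
          ‖(WL2.equiv ℂ (fun _ : TSite d (towerP L m (n + 1)) => c₀) W ωU y' - WL2.equiv ℂ (fun _ : TSite d (towerP L m (n + 1)) => c₀) W ω1 y') -
              (WL2.equiv ℂ (fun _ : TSite d (towerP L m (n + 1)) => c₀) W ωU y - WL2.equiv ℂ (fun _ : TSite d (towerP L m (n + 1)) => c₀) W ω1 y)‖ ≤
            H' * (∏ ν, Real.cosh (a * (circAbs (towerP L m (n + 1) ν) ((((x₀ ν : ℕ) : ZMod (towerP L m (n + 1) ν)) - ((y ν : ℕ) : ZMod (towerP L m (n + 1) ν))).val) : ℝ))) *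
              (tdist (towerP L m (n + 1)) y y' / (L : ℝ) ^ (n + 1)) ^ ((1 : ℝ) / 2)) →
        (∀ y : TSite d (towerP L m (n + 1)), ‖WL2.equiv ℂ (fun _ : Bond d (towerP L m (n + 1)) => c₀) W (covDerivL2K ℂ c₀ ((η : ℂ))⁻¹ (adTransportW φ U) uU) (y, μ) -
            WL2.equiv ℂ (fun _ : Bond d (towerP L m (n + 1)) => c₀) W
              (covDerivL2K ℂ c₀ ((η : ℂ))⁻¹ (adTransportW φ (fun _ : Bond d (towerP L m (n + 1)) => (1 : 𝔸ˣ))) u1) (y, μ)‖ ≤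
          M' * ∏ ν, Real.cosh (a * (circAbs (towerP L m (n + 1) ν) ((((x₀ ν : ℕ) : ZMod (towerP L m (n + 1) ν)) - ((y ν : ℕ) : ZMod (towerP L m (n + 1) ν))).val) : ℝ))) →
      ∀ b : Bond d (towerP L m (n + 1)),
        ‖WL2.equiv ℂ (fun _ : Bond d (towerP L m (n + 1)) => c₀) W (covDerivL2K ℂ c₀ ((η : ℂ))⁻¹ (adTransportW φ (fun _ : Bond d (towerP L m (n + 1)) => (1 : 𝔸ˣ)))
            (((WL2.equiv ℂ (fun _ : TSite d (towerP L m (n + 1)) => c₀) W).symm fun y =>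
                WL2.equiv ℂ (fun _ : Bond d (towerP L m (n + 1)) => c₀) W (covDerivL2K ℂ c₀ ((η : ℂ))⁻¹ (adTransportW φ U) uU) (y, μ)) -
              ((WL2.equiv ℂ (fun _ : TSite d (towerP L m (n + 1)) => c₀) W).symm fun y =>
                WL2.equiv ℂ (fun _ : Bond d (towerP L m (n + 1)) => c₀) W
                  (covDerivL2K ℂ c₀ ((η : ℂ))⁻¹ (adTransportW φ (fun _ : Bond d (towerP L m (n + 1)) => (1 : 𝔸ˣ))) u1) (y, μ)))) b‖ ≤
          ΘH * ((α + j₀) * (Nω + Hω + Mu + Mw + Mh) + (N' + H' + M')) * ∏ ν, Real.cosh (a * (circAbs (towerP L m (n + 1) ν)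
            ((((x₀ ν : ℕ) : ZMod (towerP L m (n + 1) ν)) - ((bpos b ν : ℕ) : ZMod (towerP L m (n + 1) ν))).val) : ℝ)) := by
  classical
  obtain ⟨αG, ΘG, κG, hαG, hΘG, hκG, HL2⟩ := exists_gradRow_resolvent_covDiv_holder L hL3 φ hMφ hMφ' hφ hφ' ha' hr0 hr1 τ hτ₂ hφτ hd
  obtain ⟨αg, Θg, κg, hαg, hΘg, hκg, HG⟩ := exists_gradLetter_resolvent L hL3 φ hMφ hMφ' hφ hφ' ha' hr0 hr1 τ hτ₂ hφτ hd
  obtain ⟨P, hP⟩ : ∃ P : ℝ, P = Mφ * Mφ' := ⟨_, rfl⟩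
  obtain ⟨hP0, hd1, hd0⟩ : 0 ≤ P ∧ (1 : ℝ) ≤ d ∧ (0 : ℝ) ≤ d := ⟨by rw [hP]; positivity, by exact_mod_cast hd, Nat.cast_nonneg d⟩
  refine ⟨1, ΘG * (18 * P + 42 * d * P + 36 * d * P ^ 2 + 6) + Θg * (24 * d * P + 1), min 1 (min κG κg), one_pos, by positivity,
    lt_min one_pos (lt_min hκG hκg), ?_⟩
  intro n η hηL c₀ c₁ _ _ hw m _ U α hα hα1 hUb hUη hUw hpl j₀ hj₀ hJ hUst hpos'₁ a ha0 haκ haK1 hlamK x₀ uU ωU u1 ω1 Nω Hω Mu Mw Mh N' H' M'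
    hN0 hH0 hMu0 hMw0 hMh0 hN'0 hH'0 hM'0 hEqU hEq1 hωN hωH huN hwN μ hhN hδN hδH hδw b
  obtain ⟨haκG, haκg, haκ1⟩ : a * d * (L : ℝ) ^ (n + 1) ≤ κG ∧ a * d * (L : ℝ) ^ (n + 1) ≤ κg ∧ a * d * (L : ℝ) ^ (n + 1) ≤ 1 :=
    ⟨haκ.trans ((min_le_right _ _).trans (min_le_left _ _)), haκ.trans ((min_le_right _ _).trans (min_le_right _ _)), haκ.trans (min_le_left _ _)⟩
  -- the scale letters
  have hK1 : (1 : ℝ) ≤ (L : ℝ) ^ (n + 1) := one_le_pow₀ (by exact_mod_cast (by omega : 1 ≤ L))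
  have hK0 : (0 : ℝ) < (L : ℝ) ^ (n + 1) := lt_of_lt_of_le one_pos hK1
  set K : ℝ := (L : ℝ) ^ (n + 1) with hK
  have hη0 : 0 < η := by nlinarith only [hηL, hK0]
  have hηK : η⁻¹ = K := inv_eq_of_mul_eq_one_right hηL
  obtain ⟨hηeq, hη1⟩ : η = K⁻¹ ∧ η ≤ 1 := ⟨by rw [← hηK, inv_inv], by rw [← inv_inv η, hηK]; exact inv_le_one_of_one_le₀ hK1⟩
  have hcK : ‖((η : ℂ))⁻¹‖ = K := by rw [norm_inv, Complex.norm_real, Real.norm_eq_abs, abs_of_pos hη0, hηK]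
  have hc0 : ((η : ℂ))⁻¹ ≠ 0 := inv_ne_zero (by exact_mod_cast hη0.ne')
  have hm1 : ∀ i, 1 ≤ m i := fun i => Nat.one_le_iff_ne_zero.mpr (NeZero.ne (m i))
  have hP1 : ∀ ν : Fin d, 1 ≤ towerP L m (n + 1) ν := fun ν => by
    rw [towerP_apply]; exact Nat.one_le_iff_ne_zero.2 (Nat.mul_ne_zero (pow_ne_zero _ (by omega)) (by have := hm1 ν; omega))
  have hlamh : 2 * (d : ℝ) * η⁻¹ ^ 2 * (Real.cosh a - 1) ≤ 1 / 2 := by rw [hηK]; exact hlamK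
  have he3 : Real.exp 1 ≤ 3 := by have := Real.exp_one_lt_d9; linarith only [this]
  have hea : Real.exp a ≤ 3 := (Real.exp_le_exp.2 (by nlinarith only [haK1, hK1, ha0] : a ≤ 1)).trans he3
  have heaK : Real.exp (a * d * K) ≤ 3 := (Real.exp_le_exp.2 haκ1).trans he3
  -- the weight
  set Wt : TSite d (towerP L m (n + 1)) → ℝ := fun y => ∏ ν, Real.cosh (a * (circAbs (towerP L m (n + 1) ν)
    ((((x₀ ν : ℕ) : ZMod (towerP L m (n + 1) ν)) - ((y ν : ℕ) : ZMod (towerP L m (n + 1) ν))).val) : ℝ)) with hWt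
  have hWt' : ∀ y, Wt y = ∏ ν, Real.cosh (a * (circAbs (towerP L m (n + 1) ν) ((((x₀ ν : ℕ) : ZMod (towerP L m (n + 1) ν)) - ((y ν : ℕ) : ZMod (towerP L m (n + 1) ν))).val) : ℝ)) :=
    fun _ => rfl
  have hW0 : ∀ y, 0 ≤ Wt y := fun y => (weight_site_pos (towerP L m (n + 1)) a x₀ y).le
  have hWs : ∀ y κ, Wt (shift κ y) ≤ 3 * Wt y := fun y κ => (weight_site_shift_le ha0 x₀ y κ).trans (mul_le_mul_of_nonneg_right hea (hW0 y))
  have hWu : ∀ y κ, Wt (unshift κ y) ≤ 3 * Wt y := fun y κ => (weight_site_unshift_le ha0 x₀ y κ).trans (mul_le_mul_of_nonneg_right hea (hW0 y))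
  -- the transporters
  set R := adTransportW φ U with hR
  set S := adTransportW φ (fun bb => (U bb)⁻¹) with hS
  set R₁ := adTransportW φ (fun _ : Bond d (towerP L m (n + 1)) => (1 : 𝔸ˣ)) with hR₁
  set S₁ := adTransportW φ (fun bb => ((fun _ : Bond d (towerP L m (n + 1)) => (1 : 𝔸ˣ)) bb)⁻¹) with hS₁
  have hSR : ∀ bb w, S bb (R bb w) = w := adTransportW_inv_adTransportW' φ U
  have hR₁w : ∀ bb w, R₁ bb w = w := fun bb w => by rw [hR₁, B5Eq172HodgePositivity.adTransportW_one, LinearMap.id_apply]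
  have hS₁w : ∀ bb w, S₁ bb w = w := fun bb w => by
    show adTransportW φ (fun _ : Bond d (towerP L m (n + 1)) => (1 : 𝔸ˣ)⁻¹) bb w = w; rw [B5Eq172HodgePositivity.adTransportW_inv_one, LinearMap.id_apply]
  have hUst' : ∀ bb, star (((U bb)⁻¹ : 𝔸ˣ) : 𝔸) = ((((U bb)⁻¹)⁻¹ : 𝔸ˣ) : 𝔸) := fun bb => by rw [inv_inv, ← hUst bb, star_star]
  have hRn : ∀ bb w, ‖R bb w‖ ≤ ‖w‖ := fun bb w => (norm_adTransportW_eq φ U τ hτ₂ hUst hφτ bb w).le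
  have hSn : ∀ bb w, ‖S bb w‖ ≤ ‖w‖ := fun bb w => (norm_adTransportW_eq φ (fun bb => (U bb)⁻¹) τ hτ₂ hUst' hφτ bb w).le
  set θ : ℝ := 2 * P * α with hθ
  set ε : ℝ := 2 * Mφ * Mφ' * (α * η) with hε
  obtain ⟨hθ0, hε0⟩ : 0 ≤ θ ∧ 0 ≤ ε := ⟨by positivity, by positivity⟩
  have hRε : ∀ bb w, ‖R bb w - w‖ ≤ ε * ‖w‖ := fun bb w => norm_adTransportW_sub_le φ hφ hφ' hMφ' U bb (hUb bb) (hUη bb) w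
  have hSε : ∀ bb w, ‖S bb w - w‖ ≤ ε * ‖w‖ := fun bb w =>
    norm_adTransportW_sub_le φ hφ hφ' hMφ' (fun bb => (U bb)⁻¹) bb (inv_mem (hUb bb)) ((norm_inv_sub_one_le (hUb bb)).trans (hUη bb)) w
  have hεθ : ε ≤ θ := by rw [hε, hθ, hP]; nlinarith [mul_nonneg hMφ hMφ', mul_le_mul_of_nonneg_left hη1 hα]
  have hcε : ‖((η : ℂ))⁻¹‖ * ε ≤ θ := by rw [hcK, hε, hθ, hP, hηeq]; field_simp; nlinarith [mul_nonneg hMφ hMφ']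
  have hKε : K * ε ≤ θ := by rw [← hcK]; exact hcε
  set εL : ℝ := 2 * Mφ * Mφ' * (d * (α * η ^ 2)) with hεL
  have hεL0 : 0 ≤ εL := by positivity
  have hRL : ∀ (y y' : TSite d (towerP L m (n + 1))) (κ : Fin d) (w : W), ‖R (y, κ) w - R (y', κ) w‖ ≤ εL * tdist (towerP L m (n + 1)) y y' * ‖w‖ := by
    intro y y' κ w
    have hpath := norm_sub_le_of_step_bound hP1 (fun z => (U (z, κ) : 𝔸)) y' y (by positivity : 0 ≤ α * η ^ 2) fun p ν _ _ => hUw p κ ν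
    rw [tdist_symm hP1] at hpath
    calc ‖R (y, κ) w - R (y', κ) w‖ ≤ 2 * Mφ * Mφ' * ‖(U (y, κ) : 𝔸) - (U (y', κ) : 𝔸)‖ * ‖w‖ :=
          norm_adTransportW_sub_adTransportW_le φ hφ hφ' hMφ' U U (y, κ) (y', κ) (hUb _) (hUb _) w
      _ ≤ 2 * Mφ * Mφ' * (d * tdist (towerP L m (n + 1)) y y' * (α * η ^ 2)) * ‖w‖ := by gcongr
      _ = εL * tdist (towerP L m (n + 1)) y y' * ‖w‖ := by rw [hεL]; ring
  have hεLK : K * K * εL ≤ d * θ := by rw [hεL, hθ, hP, hηeq]; field_simp; nlinarith [mul_nonneg hMφ hMφ', hd0]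
  -- the fields
  set uf := WL2.equiv ℂ (fun _ : TSite d (towerP L m (n + 1)) => c₀) W uU with huf
  set ωf := WL2.equiv ℂ (fun _ : TSite d (towerP L m (n + 1)) => c₀) W ωU with hωf
  set ω1f := WL2.equiv ℂ (fun _ : TSite d (towerP L m (n + 1)) => c₀) W ω1 with hω1f
  obtain ⟨wU, hwU⟩ : ∃ w : SiteL2K ℂ d (towerP L m (n + 1)) c₀ W, w = (WL2.equiv ℂ (fun _ : TSite d (towerP L m (n + 1)) => c₀) W).symm fun y =>
      WL2.equiv ℂ (fun _ : Bond d (towerP L m (n + 1)) => c₀) W (covDerivL2K ℂ c₀ ((η : ℂ))⁻¹ R uU) (y, μ) := ⟨_, rfl⟩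
  obtain ⟨w1, hw1⟩ : ∃ w : SiteL2K ℂ d (towerP L m (n + 1)) c₀ W, w = (WL2.equiv ℂ (fun _ : TSite d (towerP L m (n + 1)) => c₀) W).symm fun y =>
      WL2.equiv ℂ (fun _ : Bond d (towerP L m (n + 1)) => c₀) W (covDerivL2K ℂ c₀ ((η : ℂ))⁻¹ R₁ u1) (y, μ) := ⟨_, rfl⟩
  obtain ⟨AU, hAU⟩ : ∃ A : BondL2K ℂ d (towerP L m (n + 1)) c₀ W, A = (WL2.equiv ℂ (fun _ : Bond d (towerP L m (n + 1)) => c₀) W).symm fun bb =>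
      if bb.2 = μ then -(R (bb.1, μ) (ωf (shift μ bb.1))) else 0 := ⟨_, rfl⟩
  obtain ⟨A1, hA1⟩ : ∃ A : BondL2K ℂ d (towerP L m (n + 1)) c₀ W, A = (WL2.equiv ℂ (fun _ : Bond d (towerP L m (n + 1)) => c₀) W).symm fun bb =>
      if bb.2 = μ then -(R₁ (bb.1, μ) (ω1f (shift μ bb.1))) else 0 := ⟨_, rfl⟩
  obtain ⟨CU, hCU⟩ : ∃ C : SiteL2K ℂ d (towerP L m (n + 1)) c₀ W, C = (WL2.equiv ℂ (fun _ : TSite d (towerP L m (n + 1)) => c₀) W).symm fun x =>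
      ((η : ℂ))⁻¹ • (((η : ℂ))⁻¹ • (((η : ℂ))⁻¹ • ∑ κ,
        ((R (x, μ) (R (shift μ x, κ) (uf (shift κ (shift μ x)))) - R (x, κ) (R (shift κ x, μ) (uf (shift μ (shift κ x))))) +
         (R (x, μ) (S (unshift κ (shift μ x), κ) (uf (unshift κ (shift μ x)))) -
            S (unshift κ x, κ) (R (unshift κ x, μ) (uf (shift μ (unshift κ x)))))))) := ⟨_, rfl⟩
  set wf := WL2.equiv ℂ (fun _ : TSite d (towerP L m (n + 1)) => c₀) W wU with hwf
  set w1f := WL2.equiv ℂ (fun _ : TSite d (towerP L m (n + 1)) => c₀) W w1 with hw1f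
  have hwf_apply : ∀ y, wf y = WL2.equiv ℂ (fun _ : Bond d (towerP L m (n + 1)) => c₀) W (covDerivL2K ℂ c₀ ((η : ℂ))⁻¹ R uU) (y, μ) := fun y => by
    rw [hwf, hwU, Equiv.apply_symm_apply]
  have hw1f_apply : ∀ y, w1f y = WL2.equiv ℂ (fun _ : Bond d (towerP L m (n + 1)) => c₀) W (covDerivL2K ℂ c₀ ((η : ℂ))⁻¹ R₁ u1) (y, μ) := fun y => by
    rw [hw1f, hw1, Equiv.apply_symm_apply]
  -- positivity of `Δ_1 + 1`
  have hUst1 : ∀ bb : Bond d (towerP L m (n + 1)), star ((fun _ : Bond d (towerP L m (n + 1)) => (1 : 𝔸ˣ)) bb : 𝔸) =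
      ((((fun _ : Bond d (towerP L m (n + 1)) => (1 : 𝔸ˣ)) bb)⁻¹ : 𝔸ˣ) : 𝔸) := fun _ => by simp
  have hRS1 : ∀ (bb : Bond d (towerP L m (n + 1))) (v' u' : W), ⟪R₁ bb v', u'⟫_ℂ = ⟪v', S₁ bb u'⟫_ℂ := adTransportW_adjoint φ τ hτ₂ hUst1 hφτ
  have hpos₁ : ∀ z : SiteL2K ℂ d (towerP L m (n + 1)) c₀ W, z ≠ 0 →
      0 < RCLike.re ⟪z, ((covLaplaceSiteK (c₀ := c₀) ((η : ℂ))⁻¹ R₁ S₁ + (1 : ℂ) • LinearMap.id :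
        SiteL2K ℂ d (towerP L m (n + 1)) c₀ W →ₗ[ℂ] SiteL2K ℂ d (towerP L m (n + 1)) c₀ W)) z⟫_ℂ := by
    have h := rePos_covLaplaceSiteK_add (c₀ := c₀) η⁻¹ one_pos R₁ S₁ hRS1; simp only [Complex.ofReal_inv, Complex.ofReal_one] at h; exact h
  -- THE IDENTITY and the resolvent form of the slice difference
  have hid := laplace_add_one_hessSlice_sub_eq ((η : ℂ))⁻¹ R S R₁ S₁ hSR hR₁w hS₁w uU ωU u1 ω1 hEqU hEq1 μ wU w1 CU AU A1 hwU hw1 hAU hA1 hCU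
  set B : BondL2K ℂ d (towerP L m (n + 1)) c₀ W := covDerivL2K ℂ c₀ ((η : ℂ))⁻¹ R₁ wU - covDerivL2K ℂ c₀ ((η : ℂ))⁻¹ R wU + (AU - A1) with hB
  set Stot : SiteL2K ℂ d (towerP L m (n + 1)) c₀ W := covDivL2K ℂ c₀ ((η : ℂ))⁻¹ S₁ (covDerivL2K ℂ c₀ ((η : ℂ))⁻¹ R wU) -
      covDivL2K ℂ c₀ ((η : ℂ))⁻¹ S (covDerivL2K ℂ c₀ ((η : ℂ))⁻¹ R wU) + (covDivL2K ℂ c₀ ((η : ℂ))⁻¹ S AU - covDivL2K ℂ c₀ ((η : ℂ))⁻¹ S₁ AU) + CU + (wU - w1) with hStot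
  have hsplit : wU - w1 = greenK _ hpos₁ (covDivL2K ℂ c₀ ((η : ℂ))⁻¹ S₁ B) + greenK _ hpos₁ Stot := by rw [← map_add, ← hid, greenK_apply]
  have hgoal : (((WL2.equiv ℂ (fun _ : TSite d (towerP L m (n + 1)) => c₀) W).symm fun y =>
        WL2.equiv ℂ (fun _ : Bond d (towerP L m (n + 1)) => c₀) W (covDerivL2K ℂ c₀ ((η : ℂ))⁻¹ (adTransportW φ U) uU) (y, μ)) -
      ((WL2.equiv ℂ (fun _ : TSite d (towerP L m (n + 1)) => c₀) W).symm fun y =>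
        WL2.equiv ℂ (fun _ : Bond d (towerP L m (n + 1)) => c₀) W
          (covDerivL2K ℂ c₀ ((η : ℂ))⁻¹ (adTransportW φ (fun _ : Bond d (towerP L m (n + 1)) => (1 : 𝔸ˣ))) u1) (y, μ))) = wU - w1 := by
    rw [hwU, hw1]
  rw [hgoal, hsplit, map_add, WL2.equiv_add, Pi.add_apply]
  refine (norm_add_le _ _).trans ?_
  -- THE ROWS OF THE HÖLDER DATA `B`
  have hwfN : ∀ y, ‖wf y‖ ≤ Mw * Wt y := fun y => by rw [hwf_apply]; exact hwN (y, μ)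
  have hwfg : ∀ bb, ‖covDeriv ((η : ℂ))⁻¹ R wf bb‖ ≤ Mh * Wt (bpos bb) := fun bb => by rw [hwf, ← equiv_covDerivL2K, hwU]; exact hhN bb
  have hBf : ∀ bb, WL2.equiv ℂ (fun _ : Bond d (towerP L m (n + 1)) => c₀) W B bb =
      ((η : ℂ))⁻¹ • (wf (btgt bb) - R bb (wf (btgt bb))) +
        ((if bb.2 = μ then -(R (bb.1, μ) (ωf (shift μ bb.1))) else 0) - (if bb.2 = μ then -(R₁ (bb.1, μ) (ω1f (shift μ bb.1))) else 0)) := by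
    intro bb
    rw [hB, WL2.equiv_add, WL2.equiv_sub, WL2.equiv_sub, Pi.add_apply, Pi.sub_apply, Pi.sub_apply, equiv_covDerivL2K, equiv_covDerivL2K, ← hwf,
      covDeriv_trivial_sub_covDeriv_apply _ R R₁ hR₁w, hAU, hA1, Equiv.apply_symm_apply, Equiv.apply_symm_apply]
  have hBsup : ∀ bb, ‖WL2.equiv ℂ (fun _ : Bond d (towerP L m (n + 1)) => c₀) W B bb‖ ≤ 3 * (θ * Mw + θ * Nω + N') * Wt (bpos bb) := fun bb => by
    rw [hBf]
    exact supRow_sliceB ha0 hea x₀ Wt hWt' _ R R₁ hR₁w hε0 hθ0 hεθ hcε hRε wf ωf ω1f hMw0 hN0 hN'0 hwfN hωN hδN μ bb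
  have hBholder : ∀ (y y' : TSite d (towerP L m (n + 1))) (κ : Fin d), tdist (towerP L m (n + 1)) y y' ≤ K →
      ‖WL2.equiv ℂ (fun _ : Bond d (towerP L m (n + 1)) => c₀) W B (y', κ) - WL2.equiv ℂ (fun _ : Bond d (towerP L m (n + 1)) => c₀) W B (y, κ)‖ ≤
        (9 * d * θ * (Mh + θ * Mw) + 3 * d * θ * Mw + 9 * d * θ * Nω + 3 * θ * Hω + 3 * H') * Wt y * (tdist (towerP L m (n + 1)) y y' / K) ^ ((1 : ℝ) / 2) := by
    intro y y' κ hyy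
    rw [hBf, hBf]
    exact holderRow_sliceB ha0 hea hK1 heaK x₀ Wt hWt' _ hcK R R₁ hR₁w hε0 hεL0 hθ0 hεθ hKε hεLK hRε hRL wf ωf ω1f hMw0 hMh0 hN0 hH0 hH'0 hwfN hwfg hωN
      hωH hδH μ y y' κ hyy
  -- THE FLAT CLASS DATA and the (3.44)-letter on `B`
  have hUb1 : ∀ bb : Bond d (towerP L m (n + 1)), (fun _ : Bond d (towerP L m (n + 1)) => (1 : 𝔸ˣ)) bb ∈ U1 𝔸 := fun _ => one_mem _
  have hUη1 : ∀ bb : Bond d (towerP L m (n + 1)), ‖(((fun _ : Bond d (towerP L m (n + 1)) => (1 : 𝔸ˣ)) bb : 𝔸ˣ) : 𝔸) - 1‖ ≤ 0 * η := fun _ => by simp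
  have hUgrad1 : ∀ (x : TSite d (towerP L m (n + 1))) (ν : Fin d), ‖(((fun _ : Bond d (towerP L m (n + 1)) => (1 : 𝔸ˣ)) (x, ν) : 𝔸ˣ) : 𝔸) -
      (fun _ : Bond d (towerP L m (n + 1)) => (1 : 𝔸ˣ)) (unshift ν x, ν)‖ ≤ 0 * η ^ 2 := fun _ _ => by simp
  have hεg1 : ∀ j < n + 1, (fun _ : ℕ => (0 : ℝ)) j ≤ 0 * r ^ j := fun _ _ => by simp
  have hUε1 : ∀ (j : ℕ) (bb : Bond d (towerP L m (j + 1))), ‖(UlevOf L m (n + 1) (fun _ : Bond d (towerP L m (n + 1)) => (1 : 𝔸ˣ)) j bb : 𝔸) - 1‖ ≤ (fun _ : ℕ => (0 : ℝ)) j :=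
    fun j bb => by rw [UlevOf_one]; simp
  have hLb1 : ∀ (j : ℕ) (bb : Bond d (towerP L m (j + 1))), UlevOf L m (n + 1) (fun _ : Bond d (towerP L m (n + 1)) => (1 : 𝔸ˣ)) j bb ∈ U1 𝔸 := fun j bb => by
    rw [UlevOf_one]; exact one_mem _
  have hRlev1 : ∀ (j : ℕ) (bb : Bond d (towerP L m (j + 1))) (w : W), ‖adTransportW φ (UlevOf L m (n + 1) (fun _ : Bond d (towerP L m (n + 1)) => (1 : 𝔸ˣ)) j) bb w‖ ≤ ‖w‖ :=
    fun j bb w => by rw [UlevOf_one, B5Eq172HodgePositivity.adTransportW_one, LinearMap.id_apply]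
  have h1 := HL2 n η hηL c₀ c₁ hw m (fun _ => 1) 0 le_rfl hαG.le hUb1 hUη1 hUgrad1 (fun _ => 0) (fun _ => le_rfl) hεg1 hUε1 hLb1 hUst1 hRlev1 hpos'₁ hpos₁
    a ha0 haκG haK1 hlamK x₀ B (3 * (θ * Mw + θ * Nω + N')) (9 * d * θ * (Mh + θ * Mw) + 3 * d * θ * Mw + 9 * d * θ * Nω + 3 * θ * Hω + 3 * H')
    (by positivity) (by positivity) hBsup hBholder b
  -- THE ROW OF THE SUP DATA `S`
  have hAN : ∀ bb, ‖WL2.equiv ℂ (fun _ : Bond d (towerP L m (n + 1)) => c₀) W AU bb‖ ≤ Nω * 3 * Wt (bpos bb) := fun bb => by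
    rw [hAU, Equiv.apply_symm_apply]
    exact (norm_A_apply_le ha0 x₀ Wt hWt' R hRn ωf hN0 hωN μ bb).trans (by gcongr)
  have hS1 : ∀ y, ‖WL2.equiv ℂ (fun _ : TSite d (towerP L m (n + 1)) => c₀) W (covDivL2K ℂ c₀ ((η : ℂ))⁻¹ S₁ (covDerivL2K ℂ c₀ ((η : ℂ))⁻¹ R wU) -
      covDivL2K ℂ c₀ ((η : ℂ))⁻¹ S (covDerivL2K ℂ c₀ ((η : ℂ))⁻¹ R wU)) y‖ ≤ 3 * d * θ * Mh * Wt y := fun y => by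
    rw [WL2.equiv_sub, Pi.sub_apply, equiv_covDivL2K, equiv_covDivL2K, equiv_covDerivL2K, ← hwf]
    refine (norm_covDiv_trivial_sub_covDiv_apply_le ha0 x₀ Wt hWt' _ S S₁ hS₁w hε0 hSε _ hMh0 hwfg y).trans ?_
    have e : ‖((η : ℂ))⁻¹‖ * (ε * d * Mh * Real.exp a) * Wt y = (‖((η : ℂ))⁻¹‖ * ε) * Real.exp a * (d * Mh * Wt y) := by ring
    rw [e]
    calc (‖((η : ℂ))⁻¹‖ * ε) * Real.exp a * (d * Mh * Wt y) ≤ θ * 3 * (d * Mh * Wt y) := by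
          have := hW0 y; gcongr
      _ = 3 * d * θ * Mh * Wt y := by ring
  have hS2 : ∀ y, ‖WL2.equiv ℂ (fun _ : TSite d (towerP L m (n + 1)) => c₀) W (covDivL2K ℂ c₀ ((η : ℂ))⁻¹ S AU - covDivL2K ℂ c₀ ((η : ℂ))⁻¹ S₁ AU) y‖ ≤
      9 * d * θ * Nω * Wt y := fun y => by
    rw [WL2.equiv_sub, Pi.sub_apply, equiv_covDivL2K, equiv_covDivL2K, norm_sub_rev]
    refine (norm_covDiv_trivial_sub_covDiv_apply_le ha0 x₀ Wt hWt' _ S S₁ hS₁w hε0 hSε _ (by positivity : (0 : ℝ) ≤ Nω * 3) hAN y).trans ?_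
    have e : ‖((η : ℂ))⁻¹‖ * (ε * d * (Nω * 3) * Real.exp a) * Wt y = (‖((η : ℂ))⁻¹‖ * ε) * Real.exp a * (3 * d * Nω * Wt y) := by ring
    rw [e]
    calc (‖((η : ℂ))⁻¹‖ * ε) * Real.exp a * (3 * d * Nω * Wt y) ≤ θ * 3 * (3 * d * Nω * Wt y) := by
          have := hW0 y; gcongr
      _ = 9 * d * θ * Nω * Wt y := by ring
  have hS3 : ∀ y, ‖WL2.equiv ℂ (fun _ : TSite d (towerP L m (n + 1)) => c₀) W CU y‖ ≤ P * (24 * d) * ((j₀ + α) * (Mu + Mw)) * Wt y := fun y => by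
    rw [hCU, Equiv.apply_symm_apply]
    have hC := norm_commutator_sum_le φ hφ hφ' hMφ hMφ' U hUb hη0 hα hpl hRn hSn uf μ y
    have hDuf : covDeriv ((η : ℂ))⁻¹ (adTransportW φ U) uf = WL2.equiv ℂ (fun _ : Bond d (towerP L m (n + 1)) => c₀) W (covDerivL2K ℂ c₀ ((η : ℂ))⁻¹ (adTransportW φ U) uU) := by
      rw [huf, equiv_covDerivL2K]
    rw [hDuf] at hC
    refine hC.trans ?_
    have hu1 : ‖uf (shift μ y)‖ ≤ Mu * (3 * Wt y) := (huN _).trans (mul_le_mul_of_nonneg_left (hWs _ _) hMu0)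
    have hsum : ∑ κ : Fin d, (‖WL2.equiv ℂ (fun _ : Bond d (towerP L m (n + 1)) => c₀) W (covDerivL2K ℂ c₀ ((η : ℂ))⁻¹ (adTransportW φ U) uU) (shift μ y, κ)‖ +
        ‖WL2.equiv ℂ (fun _ : Bond d (towerP L m (n + 1)) => c₀) W (covDerivL2K ℂ c₀ ((η : ℂ))⁻¹ (adTransportW φ U) uU) (unshift κ (shift μ y), κ)‖) ≤ d * (12 * Mw * Wt y) := by
      calc _ ≤ ∑ _κ : Fin d, 12 * Mw * Wt y := Finset.sum_le_sum fun κ _ => by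
              linarith [(hwN (shift μ y, κ)).trans (mul_le_mul_of_nonneg_left (hWs y μ) hMw0), hW0 y,
                (hwN (unshift κ (shift μ y), κ)).trans (mul_le_mul_of_nonneg_left ((hWu _ κ).trans (mul_le_mul_of_nonneg_left (hWs y μ) (by norm_num))) hMw0)]
        _ = d * (12 * Mw * Wt y) := by rw [Finset.sum_const, Finset.card_univ, Fintype.card_fin, nsmul_eq_mul]
    have hcoef : 2 * ‖J (fun μ => shiftEquiv (Pd := towerP L m (n + 1)) μ) (fun μ y => U (y, μ)) η μ y‖ + 8 * d * α ^ 2 * η ≤ 8 * d * (j₀ + α) := by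
      have h2 : α ^ 2 * η ≤ α := by nlinarith [mul_le_mul_of_nonneg_left hη1 (sq_nonneg α), mul_le_mul_of_nonneg_left hα1 hα]
      nlinarith [mul_le_mul_of_nonneg_left h2 (by positivity : (0 : ℝ) ≤ 8 * d), hd1, hj₀, hJ μ y]
    have hW := hW0 y
    calc Mφ * Mφ' * ((2 * ‖J (fun μ => shiftEquiv (Pd := towerP L m (n + 1)) μ) (fun μ y => U (y, μ)) η μ y‖ + 8 * d * α ^ 2 * η) * ‖uf (shift μ y)‖ +
          2 * α * ∑ κ : Fin d, (‖WL2.equiv ℂ (fun _ : Bond d (towerP L m (n + 1)) => c₀) W (covDerivL2K ℂ c₀ ((η : ℂ))⁻¹ (adTransportW φ U) uU) (shift μ y, κ)‖ +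
            ‖WL2.equiv ℂ (fun _ : Bond d (towerP L m (n + 1)) => c₀) W (covDerivL2K ℂ c₀ ((η : ℂ))⁻¹ (adTransportW φ U) uU) (unshift κ (shift μ y), κ)‖))
        ≤ Mφ * Mφ' * (8 * d * (j₀ + α) * (Mu * (3 * Wt y)) + 2 * α * (d * (12 * Mw * Wt y))) := by
          have hMM : 0 ≤ Mφ * Mφ' := mul_nonneg hMφ hMφ'
          refine mul_le_mul_of_nonneg_left (add_le_add (mul_le_mul hcoef hu1 (norm_nonneg _) (by positivity)) ?_) hMM
          exact mul_le_mul_of_nonneg_left hsum (by positivity)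
      _ ≤ P * (24 * d) * ((j₀ + α) * (Mu + Mw)) * Wt y := by
          rw [← hP]
          have : 2 * α * (d * (12 * Mw * Wt y)) ≤ 24 * d * (j₀ + α) * (Mw * Wt y) := by nlinarith [mul_nonneg hd0 (mul_nonneg hMw0 hW), hj₀, hα]
          nlinarith [this, hP0]
  have hS4 : ∀ y, ‖WL2.equiv ℂ (fun _ : TSite d (towerP L m (n + 1)) => c₀) W (wU - w1) y‖ ≤ M' * Wt y := fun y => by
    rw [WL2.equiv_sub, Pi.sub_apply, ← hwf, ← hw1f, hwf_apply, hw1f_apply]; exact hδw y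
  have hSsup : ∀ y, ‖WL2.equiv ℂ (fun _ : TSite d (towerP L m (n + 1)) => c₀) W Stot y‖ ≤
      (3 * d * θ * Mh + 9 * d * θ * Nω + P * (24 * d) * ((j₀ + α) * (Mu + Mw)) + M') * Wt y := fun y => by
    rw [hStot, WL2.equiv_add, WL2.equiv_add, WL2.equiv_add, Pi.add_apply, Pi.add_apply, Pi.add_apply]
    refine (norm_add_le _ _).trans ((add_le_add ((norm_add_le _ _).trans (add_le_add ((norm_add_le _ _).trans (add_le_add (hS1 y) (hS2 y))) (hS3 y))) (hS4 y)).trans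
      (le_of_eq ?_))
    ring
  have h2 := HG n η hηL c₀ c₁ hw m (fun _ => 1) 0 le_rfl hαg.le hUb1 hUη1 hUgrad1 (fun _ => 0) (fun _ => le_rfl) hεg1 hUε1 hLb1 hUst1 hRlev1 hpos'₁ hpos₁
    a ha0 haκg hlamh x₀ Stot _ (by positivity) hSsup b
  -- ASSEMBLY
  refine (add_le_add h1 h2).trans ?_
  have hW := hW0 (bpos b)
  have hc1 := const_FH_le (N' := N') (H' := H') (M' := M') hP0 hα hα1 hj₀ hd1 hN0 hH0 hMu0 hMw0 hMh0 hN'0 hH'0 hM'0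
  have hc2 := const_G_le (Hω := Hω) (N' := N') (H' := H') hP0 hα hj₀ hd1 hN0 hH0 hMu0 hMw0 hMh0 hN'0 hH'0 hM'0
  rw [hθ] at *
  have hX0 : 0 ≤ (α + j₀) * (Nω + Hω + Mu + Mw + Mh) + (N' + H' + M') := by positivity
  calc ΘG * (3 * (2 * P * α * Mw + 2 * P * α * Nω + N') +
          (9 * d * (2 * P * α) * (Mh + 2 * P * α * Mw) + 3 * d * (2 * P * α) * Mw + 9 * d * (2 * P * α) * Nω + 3 * (2 * P * α) * Hω + 3 * H')) * Wt (bpos b) +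
        Θg * (3 * d * (2 * P * α) * Mh + 9 * d * (2 * P * α) * Nω + P * (24 * d) * ((j₀ + α) * (Mu + Mw)) + M') * Wt (bpos b)
      ≤ ΘG * ((18 * P + 42 * d * P + 36 * d * P ^ 2 + 6) * ((α + j₀) * (Nω + Hω + Mu + Mw + Mh) + (N' + H' + M'))) * Wt (bpos b) +
          Θg * ((24 * d * P + 1) * ((α + j₀) * (Nω + Hω + Mu + Mw + Mh) + (N' + H' + M'))) * Wt (bpos b) := by
        gcongr
    _ = (ΘG * (18 * P + 42 * d * P + 36 * d * P ^ 2 + 6) + Θg * (24 * d * P + 1)) * ((α + j₀) * (Nω + Hω + Mu + Mw + Mh) + (N' + H' + M')) * Wt (bpos b) := by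
        ring

end Main

end Literature.MathematicalPhysics.QuantumFieldTheory.Balaban1983to89.B9Eq344CovariantHessianTwoBackgroundRowTower

end
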